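import Literature.AlgebraicGeometry.Motives.AlgebraicEquivalencePushforwardFacts
import Literature.AlgebraicGeometry.Motives.SubschemeCyclesProofs
import HarnessLib

/-!
# The fibres `W_t` of a family over a curve: comparison with the scheme-theoretic fibre,
# local rings, and the local rings of the curve at rational points

For a family of closed subschemes `W ↪ X ×ₖ T` and a rational point `t ∈ T(k)`, the prelude
`SubschemeCycles` defines the fibre `W_t ↪ X` (`familyFiber`) as the base change of `W ↪ X ×ₖ T`
along the slice `i_t : X ≅ X × {t} ⟶ X ×ₖ T`, and `[W_t] = familyFiberCycle W t` as the cycle of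
that closed subscheme (Fulton, *Intersection Theory*, §10.1: "`V_t = 𝒱 ∩ Y_t`", the scheme
`𝒱 ×_T {t}`; §1.5 for `[V_t]`).  This file proves the facts about `W_t` needed to compute the
multiplicities of `[W_t]` — the first step (D1 in the plan recorded with
`map_familyFiberCycle_eq_finrank_smul`, `Motives/AlgebraicEquivalencePushforwardFacts`) towards
Fulton's Prop. 10.1 (a) at the level of cycles:

* `isPullback_sliceAt`, `isPullback_familyFiber`: the slice square is cartesian, hence
  `W_t = W ×_T Spec k` (base change of `W ↪ X ×ₖ T → T` along `t : Spec k → T`);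
* `AlgPoints.isIso_descResidueField`, `exists_iso_fiber_hom_fiberι_eq`: `Spec k ≅ Spec κ(t)`
  over `T`, so `W_t ≅ (W → T).fiber t` (Mathlib `Scheme.Hom.fiber`) over `W`;
* `nonempty_stalk_familyFiber_ringEquiv`, `length_stalk_familyFiber_eq`:
  `𝒪_{W_t, w} ≅ 𝒪_{W,v} ⧸ 𝔪_t 𝒪_{W,v}` for `w ∈ W_t` over `v ∈ W` (from the fibre-stalk theorem
  of `Motives/FiberStalk`, Liu Ch. 4, proof of Thm. 3.36), hence the multiplicity
  `ℓ(𝒪_{W_t,w}) = ℓ_{𝒪_{W,v}}(𝒪_{W,v} ⧸ 𝔪_t 𝒪_{W,v})`;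
* `exists_maximalIdeal_stalk_eq_span`, `AlgPoints.height_apply_eq_zero`,
  `AlgPoints.maximalIdeal_stalk_ne_bot`: for `T` an integral curve smooth over `k`, `𝔪_t` is
  principal and nonzero at a rational point `t` (`𝒪_{T,t}` is a discrete valuation ring:
  Hartshorne III.9.7, proof; `valuationRing_stalk_of_smoothCurve`), so that
  `ℓ_{𝒪_{W,v}}(𝒪_{W,v} ⧸ 𝔪_t 𝒪_{W,v}) = ord_{𝒪_{W,v}}(π)` for a uniformiser `π`.

## References

* W. Fulton, *Intersection Theory*, 2nd ed. (1998), §1.5, §10.1.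
* Q. Liu, *Algebraic Geometry and Arithmetic Curves* (2002), Ch. 4, proof of Thm. 3.36.
* R. Hartshorne, *Algebraic Geometry* (1977), III Prop. 9.7.
* U. Görtz, T. Wedhorn, *Algebraic Geometry I*, 2nd ed. (2020), Thm. 5.22 (1).
-/

universe u

open CategoryTheory AlgebraicGeometry Limits MonoidalCategory Order IsLocalRing

noncomputable section

namespace Literature.AlgebraicGeometry.Motives

section FiberIso

variable {k : Type u} [Field k] {X T : SchemeOver k}

/-- The slice square is cartesian: `X ≅ (X ×ₖ T) ×_T {t}` via `i_t = (1, t)`, i.e.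
`i_t : X ⟶ X ×ₖ T` is the base change of the rational point `t : Spec k ⟶ T` along `pr₂`.
[folklore] -/
lemma isPullback_sliceAt (t : AlgPoints T k) :
    IsPullback (sliceAt X t).left X.hom (CartesianMonoidalCategory.snd X T).left t.toSpecHom := by
  have hR : IsPullback (CartesianMonoidalCategory.fst X T).left
      (CartesianMonoidalCategory.snd X T).left X.hom T.hom :=
    IsPullback.of_hasPullback X.hom T.hom
  have h1 : (sliceAt X t).left ≫ (CartesianMonoidalCategory.fst X T).left = 𝟙 X.left := by
    rw [← Over.comp_left, sliceAt_fst]; rfl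
  have h2 : t.toSpecHom ≫ T.hom = 𝟙 (Spec (.of k)) := by
    change t.left ≫ T.hom = _
    rw [Over.w t]
    change Spec.map (CommRingCat.ofHom (algebraMap k k)) = _
    rw [Algebra.algebraMap_self, CommRingCat.ofHom_id, Spec.map_id]
  refine IsPullback.of_right ?_ ?_ hR
  · haveI : IsIso ((sliceAt X t).left ≫ (CartesianMonoidalCategory.fst X T).left) :=
      h1 ▸ inferInstance
    haveI : IsIso (t.toSpecHom ≫ T.hom) := h2 ▸ inferInstance
    exact IsPullback.of_horiz_isIso ⟨by rw [h1, h2, Category.id_comp, Category.comp_id]⟩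
  · rw [← Over.comp_left, sliceAt_snd]; rfl

/-- **The fibre of a family is the scheme-theoretic fibre.** For `W ↪ X ×ₖ T` and `t ∈ T(k)`,
the fibre `W_t = W ×_{X × T} (X × {t})` (`familyFiber`, embedded in `X` by the second
projection) is the base change of `W → T` along `t : Spec k → T`:
the square `W_t → W`, `W_t → X → Spec k`, `W → X ×ₖ T → T`, `t` is cartesian
(Fulton, *Intersection Theory*, §10.1: `V_t = 𝒱 ∩ Y_t = 𝒱 ×_T {t}`). [folklore] -/
lemma isPullback_familyFiber (W : ClosedSubscheme (X ⊗ T).left) (t : AlgPoints T k) :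
    IsPullback (pullback.fst W.ι (sliceAt X t).left)
      (pullback.snd W.ι (sliceAt X t).left ≫ X.hom)
      (W.ι ≫ (CartesianMonoidalCategory.snd X T).left) t.toSpecHom :=
  (IsPullback.of_hasPullback W.ι (sliceAt X t).left).paste_vert (isPullback_sliceAt t)

/-- A rational point `t : Spec k ⟶ T` is `Spec k ≅ Spec κ(t) ⟶ T`: the comparison map
`κ(t) → k` is an isomorphism (it is surjective because `t` is a preimmersion). [folklore] -/
lemma AlgPoints.isIso_descResidueField (t : AlgPoints T k) :
    IsIso (T.left.descResidueField (Scheme.stalkClosedPointTo t.toSpecHom)) := by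
  set φ := T.left.descResidueField (Scheme.stalkClosedPointTo t.toSpecHom) with hφ
  haveI : IsPreimmersion t.toSpecHom := AlgPoints.isPreimmersion_left t
  have hsurj : Function.Surjective φ.hom := by
    have h1 : Function.Surjective (Scheme.stalkClosedPointTo t.toSpecHom).hom := by
      change Function.Surjective
        (t.toSpecHom.stalkMap (closedPoint k) ≫ (stalkClosedPointIso (.of k)).hom).hom
      rw [CommRingCat.hom_comp, RingHom.coe_comp]
      exact (ConcreteCategory.bijective_of_isIso _).2.comp (t.toSpecHom.stalkMap_surjective _)
    rw [← T.left.residue_descResidueField (Scheme.stalkClosedPointTo t.toSpecHom),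
      CommRingCat.hom_comp, RingHom.coe_comp] at h1
    exact Function.Surjective.of_comp h1
  have hinj : Function.Injective φ.hom := φ.hom.injective
  exact (ConcreteCategory.isIso_iff_bijective φ).mpr ⟨hinj, hsurj⟩

/-- The fibre `W_t` as the base change of `W → T` along `Spec κ(t) ⟶ T`: the square
`W_t → W`, `W_t → Spec k ≅ Spec κ(t)`, `W → T`, `Spec κ(t) → T` is cartesian. [folklore] -/
lemma isPullback_familyFiber_fromSpecResidueField (W : ClosedSubscheme (X ⊗ T).left)
    (t : AlgPoints T k) :
    haveI := AlgPoints.isIso_descResidueField t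
    IsPullback (pullback.fst W.ι (sliceAt X t).left)
      ((pullback.snd W.ι (sliceAt X t).left ≫ X.hom) ≫
        Spec.map (T.left.descResidueField (Scheme.stalkClosedPointTo t.toSpecHom)))
      (W.ι ≫ (CartesianMonoidalCategory.snd X T).left)
      (T.left.fromSpecResidueField (t.toSpecHom.base (closedPoint k))) := by
  haveI := AlgPoints.isIso_descResidueField t
  refine (isPullback_familyFiber W t).of_iso (Iso.refl _) (Iso.refl _)
    (asIso (Spec.map (T.left.descResidueField (Scheme.stalkClosedPointTo t.toSpecHom))))
    (Iso.refl _) (by simp) (by simp) (by simp) ?_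
  rw [Iso.refl_hom, Category.comp_id, asIso_hom,
    Scheme.descResidueField_stalkClosedPointTo_fromSpecResidueField]

variable (W : ClosedSubscheme (X ⊗ T).left) (t : AlgPoints T k)

/-- **`W_t ≅ W ×_T Spec κ(t)`.** The fibre of the family `W ↪ X ×ₖ T` at `t ∈ T(k)`
(`familyFiber`) is isomorphic, over `W`, to Mathlib's scheme-theoretic fibre
(`Scheme.Hom.fiber`) of `W ↪ X ×ₖ T → T` over the point `t`
(Fulton, *Intersection Theory*, §10.1, `V_t = 𝒱 ×_T {t}`). [folklore] -/
theorem exists_iso_fiber_hom_fiberι_eq :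
    ∃ e : (familyFiber W t).carrier ≅
        (W.ι ≫ (CartesianMonoidalCategory.snd X T).left).fiber (t.toSpecHom.base (closedPoint k)),
      e.hom ≫ (W.ι ≫ (CartesianMonoidalCategory.snd X T).left).fiberι
          (t.toSpecHom.base (closedPoint k)) =
        pullback.fst W.ι (sliceAt X t).left :=
  ⟨(isPullback_familyFiber_fromSpecResidueField W t).isoPullback,
    (isPullback_familyFiber_fromSpecResidueField W t).isoPullback_hom_fst⟩

end FiberIso

/-! ### Local rings of the fibre -/

section Stalk

variable {k : Type u} [Field k] {X T : SchemeOver k} (W : ClosedSubscheme (X ⊗ T).left)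
  (t : AlgPoints T k)

/-- **Local rings of the fibres of a family.** For `W ↪ X ×ₖ T`, `t ∈ T(k)` and a point `w` of
the fibre `W_t` lying over `v ∈ W` (under `W_t → W`), with `g : W → T` the projection:
`𝒪_{W_t, w} ≅ 𝒪_{W, v} ⧸ 𝔪_{g v} 𝒪_{W, v}` (`𝔪_{g v} = 𝔪_t`, the maximal ideal of `𝒪_{T,t}`)
(Liu, *Algebraic Geometry and Arithmetic Curves*, Ch. 4, proof of Thm. 3.36, for the
scheme-theoretic fibre; `W_t ≅ W ×_T Spec κ(t)` by `exists_iso_fiber_hom_fiberι_eq`).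
[folklore] -/
theorem nonempty_stalk_familyFiber_ringEquiv (w : (familyFiber W t).carrier) :
    Nonempty (↑((familyFiber W t).carrier.presheaf.stalk w) ≃+*
      (↑(W.carrier.presheaf.stalk ((pullback.fst W.ι (sliceAt X t).left).base w)) ⧸
        (maximalIdeal ↑(T.left.presheaf.stalk
          ((W.ι ≫ (CartesianMonoidalCategory.snd X T).left).base
            ((pullback.fst W.ι (sliceAt X t).left).base w)))).map
          ((W.ι ≫ (CartesianMonoidalCategory.snd X T).left).stalkMap
            ((pullback.fst W.ι (sliceAt X t).left).base w)).hom)) := by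
  set g := W.ι ≫ (CartesianMonoidalCategory.snd X T).left with hg
  set y := t.toSpecHom.base (closedPoint k) with hy
  obtain ⟨e, he⟩ := exists_iso_fiber_hom_fiberι_eq W t
  have hzv : (g.fiberι y).base (e.hom.base w) = (pullback.fst W.ι (sliceAt X t).left).base w := by
    have h := Scheme.Hom.comp_apply e.hom (g.fiberι y) w
    rw [he] at h
    exact h.symm
  -- `𝒪_{W_t, w} ≅ 𝒪_{fiber, z}`
  obtain ⟨e₁⟩ := nonempty_stalk_ringEquiv_of_isIso_stalkMap e.hom w (e.hom.base w) rfl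
  -- `𝒪_{fiber, z} ≅ 𝒪_{W, v} ⧸ 𝔪 𝒪_{W,v}`
  have h₂ := nonempty_stalkFiber_ringEquiv g y (e.hom.base w)
  rw [hzv] at h₂
  obtain ⟨e₂⟩ := h₂
  exact ⟨e₁.symm.trans e₂⟩

/-- **Multiplicities of the fibre cycle `[W_t]`.** With the notation of
`nonempty_stalk_familyFiber_ringEquiv`: the length of the local ring `𝒪_{W_t, w}` (the
coefficient of `[closure {w}]` in the fundamental cycle `[W_t]`, Fulton §1.5) is
`ℓ_{𝒪_{W,v}}(𝒪_{W,v} ⧸ 𝔪_t 𝒪_{W,v})`. [folklore] -/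
theorem length_stalk_familyFiber_eq (w : (familyFiber W t).carrier) :
    Module.length ↑((familyFiber W t).carrier.presheaf.stalk w)
        ↑((familyFiber W t).carrier.presheaf.stalk w) =
      Module.length ↑(W.carrier.presheaf.stalk ((pullback.fst W.ι (sliceAt X t).left).base w))
        (↑(W.carrier.presheaf.stalk ((pullback.fst W.ι (sliceAt X t).left).base w)) ⧸
          (maximalIdeal ↑(T.left.presheaf.stalk
            ((W.ι ≫ (CartesianMonoidalCategory.snd X T).left).base
              ((pullback.fst W.ι (sliceAt X t).left).base w)))).map
            ((W.ι ≫ (CartesianMonoidalCategory.snd X T).left).stalkMap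
              ((pullback.fst W.ι (sliceAt X t).left).base w)).hom) := by
  obtain ⟨e⟩ := nonempty_stalk_familyFiber_ringEquiv W t w
  rw [SubschemeCyclesProofs.length_self_eq_of_ringEquiv e]
  set O := ↑(W.carrier.presheaf.stalk ((pullback.fst W.ι (sliceAt X t).left).base w))
  exact (Module.length_eq_of_surjective (S := O) (R := O ⧸ _) (M := O ⧸ _)
    Ideal.Quotient.mk_surjective).symm

end Stalk

/-! ### The local rings of a smooth curve are discrete valuation rings -/

section Curve

variable {k : Type u} [Field k]

/-- The maximal ideal of a local ring of an integral curve smooth over a field is principal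
(the local rings are Noetherian valuation rings, `valuationRing_stalk_of_smoothCurve`;
Hartshorne III.9.7, proof). [folklore] -/
theorem exists_maximalIdeal_stalk_eq_span (T : SchemeOver k) [IsIntegral T.left]
    [SmoothOfRelativeDimension 1 T.hom] (y : T.left) :
    ∃ π : T.left.presheaf.stalk y, maximalIdeal (T.left.presheaf.stalk y) = Ideal.span {π} := by
  haveI := valuationRing_stalk_of_smoothCurve T y
  haveI : Smooth T.hom := SmoothOfRelativeDimension.smooth 1 T.hom
  haveI : IsLocallyNoetherian T.left := LocallyOfFiniteType.isLocallyNoetherian T.hom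
  have h := ((tfae_of_isNoetherianRing_of_isLocalRing_of_isDomain
    (T.left.presheaf.stalk y)).out 1 4).mp ‹ValuationRing _›
  exact h.principal

/-- The point underlying a rational point of a `k`-scheme locally of finite type has dimension
`0` (it is a closed point: `dim closure {t} = trdeg_k k = 0`, Görtz–Wedhorn I, Thm. 5.22 (1)).
[folklore] -/
theorem AlgPoints.height_apply_eq_zero (T : SchemeOver k) [LocallyOfFiniteType T.hom]
    (t : AlgPoints T k) : height (t.toSpecHom.base (closedPoint k)) = 0 := by
  haveI : IsPreimmersion t.toSpecHom := AlgPoints.isPreimmersion_left t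
  have h := Scheme.height_eq_toENat_trdeg_of_isPreimmersion T.hom (E := k) t.toSpecHom (Over.w t)
  exact h.trans (by rw [trdeg_eq_zero, map_zero])

/-- **The local ring of a smooth curve at a rational point is not a field**: its maximal ideal
is nonzero (the point has dimension `0`, so codimension `1 = dim T`, and
`dim 𝒪_{T,t} = codim`; Mathlib `ringKrullDim_stalk_eq_coheight`). Together with
`exists_maximalIdeal_stalk_eq_span`: `𝒪_{T,t}` is a discrete valuation ring with a uniformiser
`π ≠ 0` (Hartshorne III.9.7, proof). [folklore] -/
theorem AlgPoints.maximalIdeal_stalk_ne_bot (T : SchemeOver k) [IsIntegral T.left]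
    [SmoothOfRelativeDimension 1 T.hom] (t : AlgPoints T k) :
    maximalIdeal (T.left.presheaf.stalk (t.toSpecHom.base (closedPoint k))) ≠ ⊥ := by
  haveI : Smooth T.hom := SmoothOfRelativeDimension.smooth 1 T.hom
  set y := t.toSpecHom.base (closedPoint k) with hy
  have h0 : height y = 0 := AlgPoints.height_apply_eq_zero T t
  have h1 : height y + coheight y = (1 : ℕ) :=
    height_add_coheight_eq_of_smoothOfRelativeDimension T.hom 1 y
  rw [h0, zero_add, Nat.cast_one] at h1
  have hdim : ringKrullDim (T.left.presheaf.stalk y) = 1 := by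
    rw [ringKrullDim_stalk_eq_coheight y, h1]; rfl
  intro hbot
  have hF : IsField (T.left.presheaf.stalk y) := IsLocalRing.isField_iff_maximalIdeal_eq.mpr hbot
  rw [ringKrullDim_eq_zero_of_isField hF] at hdim
  exact zero_ne_one hdim

end Curve

end Literature.AlgebraicGeometry.Motives

end
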